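import Literature.MathematicalPhysics.QuantumLattice.HubbardWave0RepulsiveProofs
import HarnessLib

/-!
# Lieb's Theorem 2 for a Hubbard model with two hopping constants — I. Lieb's coordinates

Trunk T-QLATTICE, family `hubbard`. E. H. Lieb's second theorem (PRL 62 (1989) 1201, Theorem 2)
is stated for ANY real symmetric hopping matrix `(t_{xy})` whose graph of nonzero entries is
connected and bipartite; the tree's discharge `lieb_repulsive_halfFilling_holds`
(`HubbardWave0RepulsiveProofs`) covers the uniform-hopping Hamiltonian `hamiltonian G t U` only.
This file and its sequels (`HubbardLiebTwoHoppingsCore`, `HubbardLiebTwoHoppingsSector`) run the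
tree's proof of Theorem 2 (`HubbardWave0RepulsiveProofs`, `HubbardHalfFilledSector`,
`SpinReflectionPositivity`, `Su2Multiplet`, `SectorSpectrum`) for the Hubbard Hamiltonian with TWO
hopping constants,

  `H₂ = hamiltonian X a U + hamiltonian Y b 0`   (`X`, `Y` edge-disjoint graphs on the same sites,
  hopping `a` on the bonds of `X`, `b` on the bonds of `Y`, on-site repulsion `U`),

the case needed for the breathing / plaquette (checkerboard) Hubbard family
`H_L(a,b,U) = hamiltonian (G ∖ P) a U + hamiltonian (G ⊓ P) b 0` of Tsai–Kivelson
(`PlaquetteBreathingSelfDuality`; route `CooperPairDMottWalk` of summit `HubbardSuperconductivity`).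
The abstract inputs of the tree's proof are generic in Lieb's hopping matrix `K` (Lieb's operator
`W ↦ K W + W K - U Σ_x L_x W L_x` for any real symmetric `K` with connected graph of nonzero
entries), and for `H₂` that matrix is simply `K₂ = liebK X a n + liebK Y b n`.

Contents of part I (sub-namespace `LiebTwoHoppings`): `H₂` is Hermitian, conserves `(N↑, N↓)`,
commutes with `S^±`, `S^z`; `H₂ Φ(W) = Φ(𝓛_{K₂} W) + U n Φ(W)` in Lieb's hole-transformed
coordinates (`hamiltonian₂_mulVec_toFockN`, additivity of `liebOp` in `K`); `K₂` is real
symmetric; the exact hopping matrix element of a token slide (`hoppingMatrix_slide_eq`: `-t·sign`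
across an edge and `0` otherwise — the tree records only `≠ 0` across edges,
`LiebThm1.hoppingMatrix_hop_ne_zero`); connectivity of the graph of `K₂` for `a, b ≠ 0` when
`X ⊔ Y` is connected (`liebK₂_connected`, by `TokenSliding.exists_slide_out`); hence the
nondegenerate positive definite ground matrix of Lieb's operator (`exists_posDef_groundState₂`).

Source: E. H. Lieb, *Two theorems on the Hubbard model*, Phys. Rev. Lett. 62 (1989) 1201–1204
(Erratum 62 (1989) 1927), Theorem 2 and its proof [LiebPRL1989]. No definition and no named fact
is introduced; everything is proved.
-/

noncomputable section

namespace Literature.MathematicalPhysics.QuantumLattice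

namespace LiebTwoHoppings

open Matrix Finset LiebThm1 LiebTwo
open scoped ComplexOrder

variable {Λ : Type*} [LinearOrder Λ] [Fintype Λ]
  (X Y : SimpleGraph Λ) [DecidableRel X.Adj] [DecidableRel Y.Adj]


/-- `H₂` is Hermitian. [folklore] -/
theorem hamiltonian₂_isHermitian (a b U : ℝ) :
    (hamiltonian X a U + hamiltonian Y b 0).IsHermitian :=
  (hamiltonian_isHermitian X a U).add (hamiltonian_isHermitian Y b 0)

/-- `H₂` conserves `N↑`, `N↓`. [folklore] -/
theorem preservesSectors_hamiltonian₂ (a b U : ℝ) :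
    PreservesSectors (hamiltonian X a U + hamiltonian Y b 0) :=
  (preservesSectors_hamiltonian X a U).add (preservesSectors_hamiltonian Y b 0)

/-- `[H₂, S⁺] = 0`. [folklore] -/
theorem hamiltonian₂_commute_spinPlus (a b U : ℝ) :
    Commute (hamiltonian X a U + hamiltonian Y b 0)
      (spinPlus : Matrix (Finset (Orb Λ)) (Finset (Orb Λ)) ℂ) :=
  (hamiltonian_commute_spinPlus X a U).add_left (hamiltonian_commute_spinPlus Y b 0)

/-- `[H₂, S⁻] = 0`. [folklore] -/
theorem hamiltonian₂_commute_spinMinus (a b U : ℝ) :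
    Commute (hamiltonian X a U + hamiltonian Y b 0)
      (Literature.MathematicalPhysics.QuantumLattice.spinMinus : Matrix (Finset (Orb Λ)) (Finset (Orb Λ)) ℂ) :=
  (hamiltonian_commute_spinMinus X a U).add_left (hamiltonian_commute_spinMinus Y b 0)

/-- `[H₂, S^z] = 0`. [folklore] -/
theorem hamiltonian₂_commute_spinZ (a b U : ℝ) :
    Commute (hamiltonian X a U + hamiltonian Y b 0)
      (HubbardWave0.spinZ : Matrix (Finset (Orb Λ)) (Finset (Orb Λ)) ℂ) :=
  (hamiltonian_isHermitian_and_commute_holds X a U).2.2.add_left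
    (hamiltonian_isHermitian_and_commute_holds Y b 0).2.2

/-! ### Lieb's hopping matrix of `H₂`: `K₂ = K_X(a) + K_Y(b)` -/

/-- `liebOp` is additive in `K`, the second summand carrying no interaction:
`𝓛_{K₁+K₂, U} = 𝓛_{K₁, U} + 𝓛_{K₂, 0}`. [folklore] -/
theorem liebOp_add_left {A Xs : Type*} [Fintype A] [DecidableEq A] [Fintype Xs]
    (K₁ K₂ : Matrix A A ℂ) (L : Xs → Matrix A A ℂ) (U : ℝ) (W : Matrix A A ℂ) :
    Literature.MathematicalPhysics.QuantumLattice.liebOp (K₁ + K₂) L U W =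
      Literature.MathematicalPhysics.QuantumLattice.liebOp K₁ L U W +
        Literature.MathematicalPhysics.QuantumLattice.liebOp K₂ L 0 W := by
  simp only [Literature.MathematicalPhysics.QuantumLattice.liebOp, Matrix.add_mul, Matrix.mul_add,
    Complex.ofReal_zero, zero_smul, add_zero]
  abel

/-- **`H₂` in Lieb's coordinates on the half-filled sector.** For a common bipartition colour
class `A` of `X` and `Y`: `H₂ Φ(W) = Φ(𝓛 W) + U n Φ(W)` with Lieb's operator for the summed
hopping matrix `K₂ = K_X(a) + K_Y(b)` and the attractive coupling `-U`.
[cite: LiebPRL1989, proof of Theorem 2, eqs. (4)–(5)] -/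
theorem hamiltonian₂_mulVec_toFockN (A : Finset Λ) (hAX : ∀ x y : Λ, X.Adj x y → (x ∈ A ↔ y ∉ A))
    (hAY : ∀ x y : Λ, Y.Adj x y → (x ∈ A ↔ y ∉ A)) (a b U : ℝ) (n : ℕ)
    (W : Matrix (Config Λ n) (Config Λ n) ℂ) :
    (hamiltonian X a U + hamiltonian Y b 0) *ᵥ toFockN A n W =
      toFockN A n (Literature.MathematicalPhysics.QuantumLattice.liebOp (liebK X a n + liebK Y b n)
        (fun x => Literature.MathematicalPhysics.QuantumLattice.SpinReflection.rdiag (occInd n x)) (-U) W) +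
        ((U : ℂ) * n) • toFockN A n W := by
  rw [add_mulVec, hamiltonian_mulVec_toFockN X A hAX a U n W, hamiltonian_mulVec_toFockN Y A hAY b 0 n W,
    liebOp_add_left, toFockN_add, Complex.ofReal_zero, zero_mul, zero_smul, add_zero, neg_zero]
  abel

/-- `K₂` is Hermitian and symmetric (real). [cite: LiebPRL1989, proof of Theorem 1] -/
theorem liebK₂_isHermitian_isSymm (a b : ℝ) (n : ℕ) :
    (liebK X a n + liebK Y b n).IsHermitian ∧ (liebK X a n + liebK Y b n).IsSymm := by
  refine ⟨?_, ?_⟩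
  · show (liebK X a n + liebK Y b n)ᴴ = liebK X a n + liebK Y b n
    rw [conjTranspose_add, liebK_conjTranspose, liebK_conjTranspose]
  · show (liebK X a n + liebK Y b n)ᵀ = liebK X a n + liebK Y b n
    rw [transpose_add, liebK_transpose, liebK_transpose]

/-- **The hopping matrix element of a slide.** For `y ∈ α`, `x ∉ α` the entry of the spinless
hopping matrix between `α - y + x` and `α` comes from the single term `c†_x c_y`: it is
`-t · (sign)` if `x ∼ y` and `0` otherwise. [cite: LiebPRL1989, proof of Theorem 1] -/
theorem hoppingMatrix_slide_eq {G : SimpleGraph Λ} [DecidableRel G.Adj] (t : ℝ) {α : Finset Λ}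
    {x y : Λ} (hy : y ∈ α) (hx : x ∉ α) :
    hoppingMatrix G t (insert x (α.erase y)) α =
      if G.Adj x y then -(t : ℂ) * (jwSign x (α.erase y) * jwSign y (α.erase y)) else 0 := by
  set γ := insert x (α.erase y) with hγ
  have hxγ : γ.erase x = α.erase y := erase_insert fun h => hx (mem_of_mem_erase h)
  have hαγ : α ≠ γ := fun h => hx (h ▸ mem_insert_self x _)
  -- the condition singles out `(x', y') = (x, y)`
  have key : ∀ x' y', (x' ∈ γ ∧ y' ∉ γ.erase x' ∧ α = insert y' (γ.erase x')) → x' = x ∧ y' = y := by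
    rintro x' y' ⟨hx', hy', hα⟩
    have hx'y' : x' ≠ y' := by
      rintro rfl
      exact hαγ (by rw [hα, insert_erase hx'])
    have hx'α : x' ∉ α := by
      rw [hα, mem_insert]
      rintro (h | h)
      · exact hx'y' h
      · exact notMem_erase x' γ h
    have hx'x : x' = x := by
      rcases mem_insert.1 hx' with h | h
      · exact h
      · exact absurd (mem_of_mem_erase h) hx'α
    subst hx'x
    refine ⟨rfl, ?_⟩
    rw [hxγ] at hα
    have : y ∈ insert y' (α.erase y) := hα ▸ hy
    rcases mem_insert.1 this with h | h
    · exact h.symm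
    · exact absurd h (notMem_erase y α)
  rw [hoppingMatrix_apply, Finset.sum_eq_single x, Finset.sum_eq_single y]
  · by_cases hxy : G.Adj x y
    · rw [if_pos hxy, if_pos hxy, creation_mul_annihilation_apply,
        if_pos ⟨mem_insert_self x _, hxγ ▸ notMem_erase y α, by rw [hxγ, insert_erase hy]⟩, hxγ]
    · rw [if_neg hxy, if_neg hxy, mul_zero]
  · intro y' _ hy'
    by_cases hxy' : G.Adj x y'
    · rw [if_pos hxy', creation_mul_annihilation_apply, if_neg (fun h => hy' (key x y' h).2)]
    · rw [if_neg hxy']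
  · exact fun h => absurd (mem_univ y) h
  · intro x' _ hx'
    refine Finset.sum_eq_zero fun y' _ => ?_
    by_cases hxy' : G.Adj x' y'
    · rw [if_pos hxy', creation_mul_annihilation_apply, if_neg (fun h => hx' (key x' y' h).1)]
    · rw [if_neg hxy']
  · exact fun h => absurd (mem_univ x) h

/-- **Connectivity of `K₂`.** If `X` and `Y` are edge-disjoint with connected union, `a ≠ 0` and
`b ≠ 0`, then the graph of nonzero entries of `K₂ = K_X(a) + K_Y(b)` on `n`-subsets is connected
(token sliding along `X ⊔ Y`; each slide is an edge of exactly one of `X`, `Y`).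
[cite: LiebPRL1989, proof of Theorem 1(b)] -/
theorem liebK₂_connected (hG : (X ⊔ Y).Connected) (hXY : ∀ x y, X.Adj x y → ¬ Y.Adj x y)
    {a b : ℝ} (ha : a ≠ 0) (hb : b ≠ 0) (n : ℕ) (S : Set (Config Λ n))
    (hSa : ∃ α, α ∈ S) (hSb : ∃ β, β ∉ S) :
    ∃ α ∈ S, ∃ β ∉ S, (liebK X a n + liebK Y b n) α β ≠ 0 := by
  classical
  set S' : Set (Finset Λ) := {c | ∃ h : c.card = n, (⟨c, h⟩ : Config Λ n) ∈ S} with hS'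
  obtain ⟨α, hα⟩ := hSa
  obtain ⟨β, hβ⟩ := hSb
  have ha' : ∃ c ∈ S', c.card = n := ⟨α.1, ⟨α.2, by simpa using hα⟩, α.2⟩
  have hb' : ∃ c ∉ S', c.card = n := ⟨β.1, by rintro ⟨h, h'⟩; exact hβ (by simpa using h'), β.2⟩
  obtain ⟨c, hcS, hcn, x, hx, y, hy, hxy, hout⟩ := exists_slide_out (X ⊔ Y) hG n S' ha' hb'
  obtain ⟨h1, h2⟩ := hcS
  have hcard : (insert y (c.erase x)).card = n := by rw [card_slide hx hy, hcn]
  refine ⟨⟨c, hcn⟩, h2, ⟨insert y (c.erase x), hcard⟩, fun h => hout ⟨hcard, h⟩, ?_⟩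
  show hoppingMatrix X a c (insert y (c.erase x)) + hoppingMatrix Y b c (insert y (c.erase x)) ≠ 0
  rw [hoppingMatrix_transpose_apply a (insert y (c.erase x)) c,
    hoppingMatrix_transpose_apply b (insert y (c.erase x)) c, hoppingMatrix_slide_eq a hx hy,
    hoppingMatrix_slide_eq b hx hy]
  have hj : ∀ (i : Λ) (s : Finset Λ), jwSign i s ≠ 0 := fun i s h => by
    simpa [h] using jwSign_mul_self i s
  have hsgn : jwSign y (c.erase x) * jwSign x (c.erase x) ≠ 0 := mul_ne_zero (hj _ _) (hj _ _)
  rcases (SimpleGraph.sup_adj _ _ _ _).1 hxy.symm with hX | hY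
  · rw [if_pos hX, if_neg (hXY y x hX), add_zero]
    exact mul_ne_zero (neg_ne_zero.2 (Complex.ofReal_ne_zero.2 ha)) hsgn
  · rw [if_neg (fun h => hXY y x h hY), if_pos hY, zero_add]
    exact mul_ne_zero (neg_ne_zero.2 (Complex.ofReal_ne_zero.2 hb)) hsgn

/-- **Lieb's lemma for `H₂` in the half-filled `S^z = 0` sector (matrix form).** For `X`, `Y`
edge-disjoint with connected union, `a, b ≠ 0` and `U > 0`, the lowest eigenvalue of Lieb's
operator `W ↦ K₂ W + W K₂ - U Σ_x L_x W L_x` is nondegenerate with a positive definite eigenmatrix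
(spin-space reflection positivity, `SpinReflectionPositivity.exists_posDef_groundState_unique`).
[cite: LiebPRL1989, proof of Theorem 2] -/
theorem exists_posDef_groundState₂ (hG : (X ⊔ Y).Connected) (hXY : ∀ x y, X.Adj x y → ¬ Y.Adj x y)
    {a b U : ℝ} (ha : a ≠ 0) (hb : b ≠ 0) (hU : 0 < U) (n : ℕ) [Nonempty (Config Λ n)] :
    ∃ W₀ : Matrix (Config Λ n) (Config Λ n) ℂ, W₀.PosDef ∧
      vec W₀ ∈ (Literature.MathematicalPhysics.QuantumLattice.SpinReflection.liebMatrix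
        (liebK X a n + liebK Y b n) (occInd n) (-U)).groundSpace ∧
      ∀ v ∈ (Literature.MathematicalPhysics.QuantumLattice.SpinReflection.liebMatrix
        (liebK X a n + liebK Y b n) (occInd n) (-U)).groundSpace, ∃ c : ℂ, v = c • vec W₀ :=
  Literature.MathematicalPhysics.QuantumLattice.SpinReflection.exists_posDef_groundState_unique
    (liebK₂_isHermitian_isSymm X Y a b n) (neg_lt_zero.2 hU) (fun α β h => occInd_separating n α β h)
    (liebK₂_connected X Y hG hXY ha hb n)

end LiebTwoHoppings

end Literature.MathematicalPhysics.QuantumLattice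

end
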